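import Literature.NumberTheory.EllipticCurves.RankinSelbergBaseChangeLocalFactorProofs
import Literature.NumberTheory.GaloisRepresentations.DegreeOnePlacesProofs
import Literature.NumberTheory.GaloisRepresentations.DecomposedGenericInfinite
import Mathlib.NumberTheory.NumberField.Discriminant.Different
import HarnessLib

/-!
# The Hecke character `ψ_θ ∘ N_{K/ℚ}` at the places over a good prime, and the Artin formalism
# for `f` over a quadratic field modulo the bad primes

Topic `NumberTheory/EllipticCurves` (namespace `Literature.NumberTheory.EllipticCurves`).
Everything here is PROVED (theorems only; no definitions, no named facts).

Third step of a discharge of the named fact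
`Literature.NumberTheory.EllipticCurves.rankinSelbergEulerProductHecke_baseChangeDirichlet_eq`
(`RankinSelbergBaseChangeDirichlet.lean`), after the global step
(`RankinSelbergEulerProductHeckeRegroupProofs.lean`) and the local bookkeeping
(`RankinSelbergBaseChangeLocalFactorProofs.lean`):

* `compRelNorm_ofDirichlet_value_of_isUnramifiedIn` — for `K/ℚ` Galois (any degree), a Dirichlet
  character `θ` mod `m`, a prime `p ∤ m` UNRAMIFIED in `K` and a place `w ∣ p` of `K`: the Hecke
  character `ψ_θ ∘ N_{K/ℚ}` (`(HeckeCharacter.ofDirichlet θ).compRelNorm K`) is unramified at `w`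
  and `(ψ_θ ∘ N)(ϖ_w) = θ(p)^{f_w}`, `N(w) = p^{f_w}` — the tree's
  `HeckeCharacter.compRelNorm_valueAtUniformizer` (`(ω ∘ N)(ϖ_w) = ω(ϖ_v)^{e f}`, Cassels–Fröhlich
  VII §6.3) with `e = 1`, `ψ_θ(ϖ_p) = θ(p)` (`valueAtUniformizer_ofDirichlet`) and
  `N(w) = p^{f}` (Mathlib `absNorm_eq_pow_inertiaDeg'_of_liesOver`); the same with the hypothesis
  `p ∤ d_K` (Dedekind's discriminant theorem, Mathlib `NumberField.not_dvd_discr_iff_isUnramifiedIn`).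
* `rankinSelbergEulerProductHecke_baseChange_eq_mul_twist_of_bad_values` — consequently, for `K`
  quadratic, `κ` its Kronecker character, `f` a normalised eigenform, `θ` mod `m` and `re s > 2`,
  the conclusion of `rankinSelbergEulerProductHecke_baseChangeDirichlet_eq`,
  `rankinSelbergEulerProductHecke f (ψ_θ ∘ N) s = L(f ⊗ θ, s) · L(f ⊗ θκ, s)`, holds AS SOON AS the
  extended-by-zero Hecke values at the finitely many places over the primes `p ∣ m·d_K` are
  `θ(p)^{f_w}` (i.e. `0` over `p ∣ m`, and `θ(p)` at the ramified place over `p ∣ d_K`, `p ∤ m`).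
  These two local evaluations (norms of uniformizers at a ramified place; ramification of
  `ψ_θ ∘ N` above `p ∣ cond θ` for `p` unramified in `K`) are what remains for `…_holds`.

## References

* [Gross2004] B. H. Gross, *Heegner points and representation theory*, MSRI Publ. 49 (2004), §3
  (p. 40) and §13 (p. 49).
* [CasselsFrohlichANT1967] J. W. S. Cassels, A. Fröhlich (eds.), *Algebraic Number Theory* (1967),
  Ch. VII (Tate), §6.3.
* [NeukirchANT1999] J. Neukirch, *Algebraic Number Theory* (1999), Ch. III (2.12) (Dedekind's
  discriminant theorem), Ch. VII (6.?) — (10.4) (iv).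
-/

noncomputable section

open scoped MatrixGroups ModularForm NumberTheorySymbols
open Module NumberField Ideal IsDedekindDomain CongruenceSubgroup Rat.HeightOneSpectrum
open Literature.NumberTheory.GaloisRepresentations
open Literature.NumberTheory.EllipticCurves.ModularForms

namespace Literature.NumberTheory.EllipticCurves

/-! ### `ψ_θ ∘ N` at the places over an unramified prime `p ∤ m` -/

section GoodPrimes

variable (K : Type) [Field K] [NumberField K] [IsGalois ℚ K] {m : ℕ} [NeZero m]

omit [NumberField K] [IsGalois ℚ K] in
/-- A prime of `𝓞 K` over `pℤ` contains `p`. [cite: NeukirchANT1999, Ch. I §8 (8.1)] -/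
theorem natCast_mem_of_mem_primesOver {p : ℕ} {w : HeightOneSpectrum (𝓞 K)}
    (hw : w.asIdeal ∈ primesOver (span {(p : ℤ)}) (𝓞 K)) : (p : 𝓞 K) ∈ w.asIdeal := by
  have h : (p : ℤ) ∈ w.asIdeal.under ℤ := by
    rw [← hw.2.over]
    exact Ideal.mem_span_singleton_self _
  rw [Ideal.mem_comap, map_natCast] at h
  exact h

/-- **`ψ_θ ∘ N_{K/ℚ}` at a place over a good prime.** Let `K/ℚ` be Galois, `θ` a Dirichlet
character mod `m`, `p ∤ m` a prime unramified in `K` and `w` a place of `K` over `p`, of residue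
degree `f_w` (`N(w) = p^{f_w}`). Then `ψ_θ ∘ N_{K/ℚ}` is unramified at `w` and its value at a
uniformizer is `θ(p)^{f_w}` (`(ω ∘ N)(ϖ_w) = ω(ϖ_p)^{e f}` with `e = 1` and `ψ_θ(ϖ_p) = θ(p)`).
[cite: CasselsFrohlichANT1967, Ch. VII §6.3 (PDF p. 215)] [cite: Gross2004, §3 (p. 40)] -/
theorem compRelNorm_ofDirichlet_value_of_isUnramifiedIn (θ : DirichletCharacter ℂ m) {p : ℕ}
    (hp : p.Prime) (hpm : ¬ p ∣ m) (hK : Algebra.IsUnramifiedIn (𝓞 K) (span {(p : ℤ)}))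
    {w : HeightOneSpectrum (𝓞 K)} (hw : w.asIdeal ∈ primesOver (span {(p : ℤ)}) (𝓞 K)) :
    ((HeckeCharacter.ofDirichlet θ).compRelNorm K).IsUnramifiedAt w ∧
      ((HeckeCharacter.ofDirichlet θ).compRelNorm K).valueAtUniformizer w =
        θ p ^ (absNorm w.asIdeal).factorization p := by
  have hpw : (p : 𝓞 K) ∈ w.asIdeal := natCast_mem_of_mem_primesOver K hw
  set u : HeightOneSpectrum (𝓞 ℚ) := w.under (𝓞 ℚ) with hu
  haveI : w.asIdeal.LiesOver u.asIdeal := ⟨rfl⟩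
  haveI : u.asIdeal.IsMaximal := u.isPrime.isMaximal u.ne_bot
  haveI : w.asIdeal.IsMaximal := w.isPrime.isMaximal w.ne_bot
  haveI : IsGaloisGroup (K ≃ₐ[ℚ] K) (𝓞 ℚ) (𝓞 K) := IsGaloisGroup.of_isFractionRing _ _ _ ℚ K
  have hgen : natGenerator u = p := natGenerator_under_eq_of_natCast_mem w hp hpw
  have hum : ¬ natGenerator u ∣ m := by rw [hgen]; exact hpm
  have hpu : ((p : ℕ) : 𝓞 ℚ) ∈ u.asIdeal := by
    change algebraMap (𝓞 ℚ) (𝓞 K) (p : 𝓞 ℚ) ∈ w.asIdeal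
    rwa [map_natCast]
  have hunrK : Algebra.IsUnramifiedIn (𝓞 K) u.asIdeal :=
    isUnramifiedIn_of_isUnramifiedIn_span hp hK u hpu
  have hθu : (HeckeCharacter.ofDirichlet θ).IsUnramifiedAt u :=
    HeckeCharacter.isUnramifiedAt_ofDirichlet θ hum
  refine ⟨(HeckeCharacter.ofDirichlet θ).compRelNorm_isUnramifiedAt (by rw [← hu]; exact hθu), ?_⟩
  -- exponent: `e = 1`, `N(w) = p^f`
  have he : u.asIdeal.ramificationIdxIn (𝓞 K) = 1 := by
    rw [Ideal.ramificationIdxIn_eq_ramificationIdx u.asIdeal w.asIdeal (K ≃ₐ[ℚ] K)]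
    exact hunrK.ramificationIdx_eq_one inferInstance
  have hf : absNorm w.asIdeal = p ^ u.asIdeal.inertiaDegIn (𝓞 K) := by
    rw [Ideal.inertiaDegIn_eq_inertiaDeg u.asIdeal w.asIdeal (K ≃ₐ[ℚ] K),
      ← Ideal.inertiaDeg'_eq_inertiaDeg u.asIdeal w.asIdeal,
      Ideal.absNorm_eq_pow_inertiaDeg'_of_liesOver w.asIdeal u.asIdeal u.isPrime u.ne_bot,
      Rat.absNorm_asIdeal_eq_natGenerator', hgen]
  have hfac : (absNorm w.asIdeal).factorization p = u.asIdeal.inertiaDegIn (𝓞 K) := by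
    rw [hf, Nat.factorization_pow, Finsupp.smul_apply, hp.factorization_self, smul_eq_mul, mul_one]
  rw [HeckeCharacter.compRelNorm_valueAtUniformizer (HeckeCharacter.ofDirichlet θ) hu.symm hunrK hθu,
    he, one_mul, hfac]
  change (HeckeCharacter.ofDirichlet θ).valueAtUniformizer u ^ _ = _
  rw [HeckeCharacter.valueAtUniformizer_ofDirichlet θ hum, Rat.residueCard_eq_natGenerator, hgen]

/-- The extended-by-zero Hecke value of `ψ_θ ∘ N_{K/ℚ}` at a place `w ∣ p`, `p ∤ m` unramified in
`K`: `θ(p)^{f_w}`. [cite: Gross2004, §3 (p. 40)] -/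
theorem heckeValueExtZero_compRelNorm_ofDirichlet_of_isUnramifiedIn (θ : DirichletCharacter ℂ m)
    {p : ℕ} (hp : p.Prime) (hpm : ¬ p ∣ m) (hK : Algebra.IsUnramifiedIn (𝓞 K) (span {(p : ℤ)}))
    {w : HeightOneSpectrum (𝓞 K)} (hw : w.asIdeal ∈ primesOver (span {(p : ℤ)}) (𝓞 K)) :
    heckeValueExtZero ((HeckeCharacter.ofDirichlet θ).compRelNorm K) w =
      θ p ^ (absNorm w.asIdeal).factorization p := by
  obtain ⟨hunr, hval⟩ := compRelNorm_ofDirichlet_value_of_isUnramifiedIn K θ hp hpm hK hw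
  rw [heckeValueExtZero_of_isUnramifiedAt hunr, hval]

/-- The same at a prime `p ∤ m · d_K` (`p ∤ d_K ⟺ p` unramified in `K`, Dedekind).
[cite: NeukirchANT1999, Ch. III §2 Cor. (2.12)] [cite: Gross2004, §3 (p. 40)] -/
theorem heckeValueExtZero_compRelNorm_ofDirichlet_of_not_dvd (θ : DirichletCharacter ℂ m)
    {p : ℕ} (hp : p.Prime) (hpm : ¬ p ∣ m) (hpd : ¬ (p : ℤ) ∣ NumberField.discr K)
    {w : HeightOneSpectrum (𝓞 K)} (hw : w.asIdeal ∈ primesOver (span {(p : ℤ)}) (𝓞 K)) :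
    heckeValueExtZero ((HeckeCharacter.ofDirichlet θ).compRelNorm K) w =
      θ p ^ (absNorm w.asIdeal).factorization p :=
  heckeValueExtZero_compRelNorm_ofDirichlet_of_isUnramifiedIn K θ hp hpm
    ((NumberField.not_dvd_discr_iff_isUnramifiedIn K (𝓞 K) (Nat.prime_iff_prime_int.mp hp)).mp hpd)
    hw

end GoodPrimes

/-! ### The Artin formalism modulo the bad primes -/

section Assembly

variable {K : Type} [Field K] [NumberField K] [IsGalois ℚ K] {N : ℕ}

/-- **`L(s, f_K ⊗ ψ_θ∘N) = L(f ⊗ θ, s) · L(f ⊗ θκ, s)` modulo the bad primes.** Let `K` be a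
quadratic field with Kronecker character `κ` (values `(d_K/p)` at odd `p`, `1, −1, 0` at `2` as
`d_K ≡ 1, 5 (mod 8)`, even), `f ∈ S₂(Γ₀(N))` a normalised eigenform, `θ` a Dirichlet character mod
`m` and `re s > 2`. If at every place `w` over a prime `p` with `p ∣ m` or `p ∣ d_K` the
extended-by-zero value of `ψ_θ ∘ N_{K/ℚ}` is `θ(p)^{f_w}`, then
`rankinSelbergEulerProductHecke f (ψ_θ ∘ N) s = twistedLSeries f θ s · twistedLSeries f (θκ) s` —
the conclusion of `rankinSelbergEulerProductHecke_baseChangeDirichlet_eq` for `(K, κ, f, θ, s)`;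
at the good primes the values are supplied by
`heckeValueExtZero_compRelNorm_ofDirichlet_of_not_dvd`.
[cite: Gross2004, §3 (p. 40) and §13 (p. 49)] [cite: NeukirchANT1999, Ch. VII (10.4) (iv)] -/
theorem rankinSelbergEulerProductHecke_baseChange_eq_mul_twist_of_bad_values
    (h2 : finrank ℚ K = 2) {M : ℕ} [NeZero M] (κ : DirichletCharacter ℂ M)
    (hoddp : ∀ p : ℕ, p.Prime → p ≠ 2 → κ p = (J(NumberField.discr K | p) : ℂ))
    (htwo : κ 2 = if NumberField.discr K % 8 = 1 then 1
      else if NumberField.discr K % 8 = 5 then -1 else 0)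
    [NeZero N] {f : CuspForm (Gamma0 N) 2} (hf : IsNewform0 f) {m : ℕ} [NeZero m]
    (θ : DirichletCharacter ℂ m) {s : ℂ} (hs : 2 < s.re)
    (hbad : ∀ p : ℕ, p.Prime → (p ∣ m ∨ (p : ℤ) ∣ NumberField.discr K) →
      ∀ w : HeightOneSpectrum (𝓞 K), w.asIdeal ∈ primesOver (span {(p : ℤ)}) (𝓞 K) →
        heckeValueExtZero ((HeckeCharacter.ofDirichlet θ).compRelNorm K) w =
          θ p ^ (absNorm w.asIdeal).factorization p) :
    rankinSelbergEulerProductHecke f ((HeckeCharacter.ofDirichlet θ).compRelNorm K) s =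
      twistedLSeries f θ s * twistedLSeries f (DirichletCharacter.mul θ κ) s := by
  refine rankinSelbergEulerProductHecke_eq_mul_twist_of_heckeValue h2 κ hoddp htwo hf
    (HeckeCharacter.IsFiniteOrder.compRelNorm K (HeckeCharacter.isFiniteOrder_ofDirichlet θ)) θ hs
    fun p hp w hw => ?_
  by_cases hb : p ∣ m ∨ (p : ℤ) ∣ NumberField.discr K
  · exact hbad p hp hb w hw
  · rw [not_or] at hb
    exact heckeValueExtZero_compRelNorm_ofDirichlet_of_not_dvd K θ hp hb.1 hb.2 hw

end Assembly

end Literature.NumberTheory.EllipticCurves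

end
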